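import Summits.PneNP.PneNP.Theses.PositionalGames
import Literature.Barriers.PneNP.MonotoneGapProofs
import Literature.Computability.Complexity.CircuitSizeProofs

/-!
# PneNP / PositionalGames — the inlined parity winning-region function `WIN`: monotonicity and
non-degeneracy (structural lemmas for stmt-PneNP-1299 and the parity cruxes 1294/1297/1298)

All parity statements of route `PneNP/PositionalGames` (`ParityMonotoneSuperpoly`,
`ParityMonotoneQuasipolyLower`, `ParityMonotoneQuasipolyUpper`, `ParityMonotonePoly`) speak about

  `circuitSizeOver monotoneBasis (WIN n o p v)`,
  `WIN n o p v x := decide (∃ σ, (∀ u, o u → x (u, σ u)) ∧ ∀ τ, (∀ u, ¬ o u → ¬ x (u, τ u)) →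
      Even (max priority on the lasso cycle from v under σ ⊕ τ))`

(inlined until game definitions land; see the route header). Since `circuitSizeOver monotoneBasis f`
is an `sInf` with junk value `0` exactly when `f` is non-monotone or constant, the statements are only
meaningful because `WIN` is MONOTONE in the input `x` and NON-CONSTANT for every template with at least
one Even and one Odd vertex. This file proves exactly that, written against the verbatim inlined term:

* `parityWin_mono`, `parityWin_monotone` — more Even-edge bits give more legal `σ`, more Odd bits
  (= absent Odd edges) give fewer legal `τ`; the cycle condition does not mention `x`;
* `parityWin_eq_false_of_even_deadEnd` / `parityWin_eq_true_of_odd_deadEnd` — the dead-end part of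
  the route header's decomposition `WIN = NoEvenDeadEnd ∧ (SomeOddDeadEnd ∨ W)` (legality is global);
* `parityWin_apply_bot` / `parityWin_apply_top` — with an Even vertex `WIN ⊥ = false` (no legal `σ`),
  with an Odd vertex `WIN ⊤ = true` (no legal `τ`);
* `exists_monotone_circuit_parityWin`, `exists_size_eq_circuitSizeOver_parityWin` — hence some
  `{∧₂,∨₂}` circuit computes `WIN` and `circuitSizeOver monotoneBasis WIN` is an attained minimum
  (via `Literature.Barriers.PneNP.exists_monotone_circuit`, the DNF of a monotone function).

No definitions, nothing conditional. Prover seat prover-pitem-stmt-PneNP-1299-0, 2026-08-16.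
-/

set_option linter.dupNamespace false -- `Summit.PneNP.PneNP.…`: summit = sub-problem name (D-0017 single-conjunct layout)

namespace Summit.PneNP.PneNP.Theorems

open scoped Classical
open Filter Literature.Computability.Complexity

section

variable {n : ℕ} (o : Fin n → Bool) (p : Fin n → ℕ) (v : Fin n)

/-- **`WIN` is monotone in the input** (pointwise form): if Even wins the template `(o, p, v)` on
input `x` and `x ≤ y` bitwise, Even wins on `y` — the same positional `σ` stays legal (Even bits only
switch on) and every `τ` legal on `y` was legal on `x` (Odd bits mean "edge absent"). [folklore] -/
theorem parityWin_mono {x y : Fin n × Fin n → Bool} (hxy : x ≤ y)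
    (hx : decide (∃ σ : Fin n → Fin n, (∀ u, o u = true → x (u, σ u) = true) ∧
      ∀ τ : Fin n → Fin n, (∀ u, o u = false → x (u, τ u) = false) →
        Even ((Finset.univ.filter fun u : Fin n => ∃ᶠ t : ℕ in Filter.atTop,
          (fun w : Fin n => if o w = true then σ w else τ w)^[t] v = u).sup p)) = true) :
    decide (∃ σ : Fin n → Fin n, (∀ u, o u = true → y (u, σ u) = true) ∧
      ∀ τ : Fin n → Fin n, (∀ u, o u = false → y (u, τ u) = false) →
        Even ((Finset.univ.filter fun u : Fin n => ∃ᶠ t : ℕ in Filter.atTop,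
          (fun w : Fin n => if o w = true then σ w else τ w)^[t] v = u).sup p)) = true := by
  rw [decide_eq_true_iff] at hx ⊢
  obtain ⟨σ, hσ, hwin⟩ := hx
  refine ⟨σ, fun u hu => Bool.le_iff_imp.mp (hxy (u, σ u)) (hσ u hu), fun τ hτ => hwin τ fun u hu => ?_⟩
  -- `τ` legal on `y` ⇒ legal on `x`
  cases hxu : x (u, τ u)
  · rfl
  · exact absurd (Bool.le_iff_imp.mp (hxy (u, τ u)) hxu) (by simp [hτ u hu])

/-- **`WIN` is a monotone Boolean function** of the `n²` input bits (Even bits = present edges,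
Odd bits = absent edges), for every parity template `(o, p, v)`. [folklore] -/
theorem parityWin_monotone :
    Monotone (fun x : Fin n × Fin n → Bool => decide (∃ σ : Fin n → Fin n,
      (∀ u, o u = true → x (u, σ u) = true) ∧ ∀ τ : Fin n → Fin n,
        (∀ u, o u = false → x (u, τ u) = false) →
          Even ((Finset.univ.filter fun u : Fin n => ∃ᶠ t : ℕ in Filter.atTop,
            (fun w : Fin n => if o w = true then σ w else τ w)^[t] v = u).sup p))) := by
  intro x y hxy
  exact Bool.le_iff_imp.mpr (parityWin_mono o p v hxy)

/-- **Even dead ends are fatal (globally).** If some Even vertex has no present edge on input `x`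
(reachable from `v` or not), no positional `σ` is legal and `WIN x = false` — the first conjunct
of the decomposition `WIN = NoEvenDeadEnd ∧ (SomeOddDeadEnd ∨ W)` of the route header. [folklore] -/
theorem parityWin_eq_false_of_even_deadEnd {x : Fin n × Fin n → Bool}
    (hx : ∃ u, o u = true ∧ ∀ w, x (u, w) = false) :
    decide (∃ σ : Fin n → Fin n, (∀ u, o u = true → x (u, σ u) = true) ∧
      ∀ τ : Fin n → Fin n, (∀ u, o u = false → x (u, τ u) = false) →
        Even ((Finset.univ.filter fun u : Fin n => ∃ᶠ t : ℕ in Filter.atTop,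
          (fun w : Fin n => if o w = true then σ w else τ w)^[t] v = u).sup p)) = false := by
  obtain ⟨u, hu, hrow⟩ := hx
  simp only [decide_eq_false_iff_not, not_exists, not_and]
  intro σ hσ
  exact absurd (hσ u hu) (by simp [hrow (σ u)])

/-- **Odd dead ends are fatal for Odd (globally)**, provided Even has no dead end: if every Even
vertex has a present edge and some Odd vertex has all its bits set (= all its edges absent), then a
legal `σ` exists, no `τ` is legal, and `WIN x = true` — the `SomeOddDeadEnd` disjunct of the
decomposition `WIN = NoEvenDeadEnd ∧ (SomeOddDeadEnd ∨ W)`. [folklore] -/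
theorem parityWin_eq_true_of_odd_deadEnd {x : Fin n × Fin n → Bool}
    (hE : ∀ u, o u = true → ∃ w, x (u, w) = true) (hO : ∃ u, o u = false ∧ ∀ w, x (u, w) = true) :
    decide (∃ σ : Fin n → Fin n, (∀ u, o u = true → x (u, σ u) = true) ∧
      ∀ τ : Fin n → Fin n, (∀ u, o u = false → x (u, τ u) = false) →
        Even ((Finset.univ.filter fun u : Fin n => ∃ᶠ t : ℕ in Filter.atTop,
          (fun w : Fin n => if o w = true then σ w else τ w)^[t] v = u).sup p)) = true := by
  obtain ⟨u₁, hu₁, hrow⟩ := hO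
  apply decide_eq_true
  -- a legal `σ`: at Even vertices pick a present edge, elsewhere anything
  refine ⟨fun u => if h : o u = true then (hE u h).choose else u, fun u hu => ?_, fun τ hτ => ?_⟩
  · simp only [hu, ↓reduceDIte]
    exact (hE u hu).choose_spec
  · exact absurd (hτ u₁ hu₁) (by simp [hrow (τ u₁)])

/-- On the all-`false` input a template with an Even vertex is lost by Even: that vertex has no
present edge, so no positional `σ` is legal. [folklore] -/
theorem parityWin_apply_bot (hE : ∃ u, o u = true) :
    (fun x : Fin n × Fin n → Bool => decide (∃ σ : Fin n → Fin n,
      (∀ u, o u = true → x (u, σ u) = true) ∧ ∀ τ : Fin n → Fin n,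
        (∀ u, o u = false → x (u, τ u) = false) →
          Even ((Finset.univ.filter fun u : Fin n => ∃ᶠ t : ℕ in Filter.atTop,
            (fun w : Fin n => if o w = true then σ w else τ w)^[t] v = u).sup p)))
      (fun _ => false) = false := by
  obtain ⟨u, hu⟩ := hE
  simp only [decide_eq_false_iff_not, not_exists, not_and]
  intro σ hσ
  exact absurd (hσ u hu) (by simp)

/-- On the all-`true` input a template with an Odd vertex is won by Even: every Odd edge is absent,
so no positional `τ` is legal and the `∀ τ` is vacuous (any `σ`, e.g. the identity, is legal). [folklore] -/
theorem parityWin_apply_top (hO : ∃ u, o u = false) :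
    (fun x : Fin n × Fin n → Bool => decide (∃ σ : Fin n → Fin n,
      (∀ u, o u = true → x (u, σ u) = true) ∧ ∀ τ : Fin n → Fin n,
        (∀ u, o u = false → x (u, τ u) = false) →
          Even ((Finset.univ.filter fun u : Fin n => ∃ᶠ t : ℕ in Filter.atTop,
            (fun w : Fin n => if o w = true then σ w else τ w)^[t] v = u).sup p)))
      (fun _ => true) = true := by
  obtain ⟨u, hu⟩ := hO
  apply decide_eq_true
  exact ⟨fun w => w, fun _ _ => rfl, fun τ hτ => absurd (hτ u hu) (by simp)⟩

/-- **Non-degeneracy.** For a parity template with at least one Even and one Odd vertex, `WIN` is a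
non-constant monotone function, hence computed by some circuit over the monotone basis `{∧₂, ∨₂}`
(its monotone DNF); in particular `circuitSizeOver monotoneBasis WIN` is not the junk value of an
empty infimum. [folklore] -/
theorem exists_monotone_circuit_parityWin (hE : ∃ u, o u = true) (hO : ∃ u, o u = false) :
    ∃ C : Circuit (Fin n × Fin n), C.IsOver monotoneBasis ∧ C.Computes
      (fun x : Fin n × Fin n → Bool => decide (∃ σ : Fin n → Fin n,
        (∀ u, o u = true → x (u, σ u) = true) ∧ ∀ τ : Fin n → Fin n,
          (∀ u, o u = false → x (u, τ u) = false) →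
            Even ((Finset.univ.filter fun u : Fin n => ∃ᶠ t : ℕ in Filter.atTop,
              (fun w : Fin n => if o w = true then σ w else τ w)^[t] v = u).sup p))) :=
  Literature.Barriers.PneNP.exists_monotone_circuit _ (parityWin_monotone o p v)
    (parityWin_apply_bot o p v hE) (parityWin_apply_top o p v hO)

/-- **The monotone complexity of `WIN` is attained** for every template with an Even and an Odd
vertex: some `{∧₂, ∨₂}` circuit computing `WIN` has exactly `circuitSizeOver monotoneBasis WIN` gates.
[folklore] -/
theorem exists_size_eq_circuitSizeOver_parityWin (hE : ∃ u, o u = true) (hO : ∃ u, o u = false) :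
    ∃ C : Circuit (Fin n × Fin n), C.IsOver monotoneBasis ∧ C.Computes
      (fun x : Fin n × Fin n → Bool => decide (∃ σ : Fin n → Fin n,
        (∀ u, o u = true → x (u, σ u) = true) ∧ ∀ τ : Fin n → Fin n,
          (∀ u, o u = false → x (u, τ u) = false) →
            Even ((Finset.univ.filter fun u : Fin n => ∃ᶠ t : ℕ in Filter.atTop,
              (fun w : Fin n => if o w = true then σ w else τ w)^[t] v = u).sup p))) ∧
      C.size = circuitSizeOver monotoneBasis
        (fun x : Fin n × Fin n → Bool => decide (∃ σ : Fin n → Fin n,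
          (∀ u, o u = true → x (u, σ u) = true) ∧ ∀ τ : Fin n → Fin n,
            (∀ u, o u = false → x (u, τ u) = false) →
              Even ((Finset.univ.filter fun u : Fin n => ∃ᶠ t : ℕ in Filter.atTop,
                (fun w : Fin n => if o w = true then σ w else τ w)^[t] v = u).sup p))) :=
  exists_circuit_size_eq_circuitSizeOver (exists_monotone_circuit_parityWin o p v hE hO)

end

/-- **What `ParityMonotonePoly` (stmt-PneNP-1299) actually delivers.** Because the infimum is
attained on every template with an Even and an Odd vertex, the statement is not about junk values:
it yields, for all large `n` and every such template, an honest `{∧₂, ∨₂}` circuit with at most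
`n ^ k` gates computing `WIN` ("parity games ∈ monotone P/poly"). [folklore] -/
theorem exists_small_circuit_of_parityMonotonePoly
    (h : Summit.PneNP.PneNP.Theses.PositionalGames.ParityMonotonePoly) :
    ∃ k : ℕ, ∀ᶠ n : ℕ in atTop, ∀ (o : Fin n → Bool) (p : Fin n → ℕ) (v : Fin n),
      (∃ u, o u = true) → (∃ u, o u = false) →
        ∃ C : Circuit (Fin n × Fin n), C.IsOver monotoneBasis ∧ C.Computes
          (fun x : Fin n × Fin n → Bool => decide (∃ σ : Fin n → Fin n,
            (∀ u, o u = true → x (u, σ u) = true) ∧ ∀ τ : Fin n → Fin n,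
              (∀ u, o u = false → x (u, τ u) = false) →
                Even ((Finset.univ.filter fun u : Fin n => ∃ᶠ t : ℕ in Filter.atTop,
                  (fun w : Fin n => if o w = true then σ w else τ w)^[t] v = u).sup p))) ∧
          C.size ≤ n ^ k := by
  unfold Summit.PneNP.PneNP.Theses.PositionalGames.ParityMonotonePoly at h
  obtain ⟨k, hk⟩ := h
  refine ⟨k, hk.mono fun n hn o p v hE hO => ?_⟩
  obtain ⟨C, hB, hC, hs⟩ := exists_size_eq_circuitSizeOver_parityWin o p v hE hO
  exact ⟨C, hB, hC, hs ▸ hn o p v⟩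

end Summit.PneNP.PneNP.Theorems
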